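import Mathlib
import HarnessLib
import Summits.PneNP.PneNP.Theorems.CnfIdealGenLengthRankDefectRepresentationsCutLemmaRankOneCuts

/-!
# Crux `RankDefectRepresentations` (stmt-PneNP-18923), line `rank-dehn-ladder`, stub `stub_cutLemma`: the EXPONENTIAL baseline

The cut lemma asks for `rank (R − R') ≤ poly(n) · t` with `R'` supported on equal-colour pairs, given that every coordinate cut
`X_j = R ∘ 1[row_j ≠ col_j]` has rank `≤ t`.  This file records the unconditional BASELINE with an exponential constant:

* `rank_offColour_le_exp` — `rank (R ∘ 1[row ≠ col]) ≤ (2^n − 1) · t`;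
* `cutLemma_exponential` — hence an `R'` on equal-colour pairs with `rank (R − R') ≤ (2^n − 1) · t`.

Proof: split rows and columns by the last colour bit; the two anti-diagonal blocks of `R ∘ 1[row ≠ col]` together ARE the last cut
(rank `≤ t`), and the two diagonal blocks are instances on `n − 1` coordinates whose cuts are masks of the old cuts (rank `≤ t`),
so `B(n) = 2·B(n−1) + t`.  This is the rank-metric form of the generic stability modulus for the Boolean algebra of `n`
commuting idempotents (exponential in the number of generators, cf. [arXiv:2401.04676, Thm 5.1]); the line's open question is
whether `2^n − 1` can be replaced by `poly(n)` (true in the rank-one regime `…CutLemmaRankOneCuts` and for formula-separable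
colour pairs `…CutLemmaFormulaCuts`).
HONEST FRAMING: a baseline toward one rung; the cut lemma, the crux, GL_noncomm and P ≠ NP are NOT touched; F-N2 is a FRONTIER
formal rung.
-/

set_option linter.dupNamespace false -- `Summit.PneNP.PneNP.…`: summit = sub-problem name (D-0017)

namespace Summit.PneNP.PneNP.Theorems.CnfIdealGenLengthRankDefectRepresentationsCutLemmaExponential

open Summit.PneNP.PneNP.Theorems.CnfIdealGenLengthRankDefectRepresentationsCutLemmaRankOneCuts
  (rank_mask_le fourBlocks_eq diagBlock_eq cut_restrict_eq)
open Literature.Computability.AlgebraicComplexity (rank_add_le)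

variable {K : Type} [Field K] {ι ι' : Type} [Fintype ι] [Fintype ι'] [DecidableEq ι] [DecidableEq ι']

omit [Fintype ι] [Fintype ι'] [DecidableEq ι] [DecidableEq ι'] in
/-- The two anti-diagonal blocks (by the last bit) of the off-colour part together are exactly the last cut. [folklore] -/
theorem antiBlocks_add_eq {n : ℕ} (row : ι → Fin (n + 1) → Bool) (col : ι' → Fin (n + 1) → Bool) (R : Matrix ι ι' K) :
    (Matrix.of fun x y => if row x (Fin.last n) = false ∧ col y (Fin.last n) = true then
        (Matrix.of fun x y => if row x ≠ col y then R x y else 0 : Matrix ι ι' K) x y else 0) +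
      (Matrix.of fun x y => if row x (Fin.last n) = true ∧ col y (Fin.last n) = false then
        (Matrix.of fun x y => if row x ≠ col y then R x y else 0 : Matrix ι ι' K) x y else 0) =
    Matrix.of fun x y => if row x (Fin.last n) ≠ col y (Fin.last n) then R x y else 0 := by
  ext x y
  simp only [Matrix.add_apply, Matrix.of_apply]
  cases hr : row x (Fin.last n) <;> cases hc : col y (Fin.last n)
  · simp
  · have hne : row x ≠ col y := fun heq => by
      have h := congrFun heq (Fin.last n); rw [hr, hc] at h; exact Bool.false_ne_true h
    simp [hne]
  · have hne : row x ≠ col y := fun heq => by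
      have h := congrFun heq (Fin.last n); rw [hr, hc] at h; exact Bool.false_ne_true h.symm
    simp [hne]
  · simp

/-- **Exponential baseline.** If every coordinate cut has rank `≤ t` then `rank (R ∘ 1[row ≠ col]) ≤ (2^n − 1) · t`. [folklore] -/
theorem rank_offColour_le_exp :
    ∀ (n : ℕ) (row : ι → Fin n → Bool) (col : ι' → Fin n → Bool) (R : Matrix ι ι' K) (t : ℕ),
      (∀ j, (Matrix.of fun x y => if row x j ≠ col y j then R x y else 0).rank ≤ t) →
      (Matrix.of fun x y => if row x ≠ col y then R x y else 0).rank ≤ (2 ^ n - 1) * t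
  | 0, row, col, R, t, _ => by
      have h0 : (Matrix.of fun x y => if row x ≠ col y then R x y else 0) = 0 := by
        ext x y
        have : row x = col y := funext fun j => j.elim0
        simp [this]
      rw [h0, Matrix.rank_zero]
      exact Nat.zero_le _
  | n + 1, row, col, R, t, hX => by
      have IH : ∀ β : Bool,
          (Matrix.of fun x y => if row x (Fin.last n) = β ∧ col y (Fin.last n) = β then
            (Matrix.of fun x y => if row x ≠ col y then R x y else 0 : Matrix ι ι' K) x y else 0).rank ≤ (2 ^ n - 1) * t := by
        intro β
        rw [diagBlock_eq]
        refine rank_offColour_le_exp n (fun x j => row x j.castSucc) (fun y j => col y j.castSucc) _ t fun j => ?_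
        show (Matrix.of fun x y => if row x j.castSucc ≠ col y j.castSucc then
            (Matrix.of fun x y => if row x (Fin.last n) = β ∧ col y (Fin.last n) = β then R x y else 0 : Matrix ι ι' K) x y
            else 0).rank ≤ t
        rw [cut_restrict_eq]
        exact (rank_mask_le _ _ _).trans (hX j.castSucc)
      rw [fourBlocks_eq row col (Matrix.of fun x y => if row x ≠ col y then R x y else 0), antiBlocks_add_eq]
      refine (rank_add_le _ _).trans ?_
      refine (Nat.add_le_add ((rank_add_le _ _).trans (Nat.add_le_add (IH false) (IH true))) (hX (Fin.last n))).trans ?_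
      have h1 : 1 ≤ 2 ^ n := Nat.one_le_two_pow
      have : (2 ^ n - 1) * t + (2 ^ n - 1) * t + t = (2 ^ (n + 1) - 1) * t := by
        rw [pow_succ]
        zify [h1, (by omega : 1 ≤ 2 ^ n * 2)]
        ring
      omega

/-- **The cut lemma with an exponential constant** (baseline): an `R'` supported on equal-colour pairs with
`rank (R − R') ≤ (2^n − 1) · t`. [folklore] -/
theorem cutLemma_exponential {n : ℕ} (row : ι → Fin n → Bool) (col : ι' → Fin n → Bool) (t : ℕ) (R : Matrix ι ι' K)
    (hX : ∀ j : Fin n, (Matrix.of fun x y => if row x j ≠ col y j then R x y else 0).rank ≤ t) :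
    ∃ R' : Matrix ι ι' K, (∀ x y, row x ≠ col y → R' x y = 0) ∧ (R - R').rank ≤ (2 ^ n - 1) * t := by
  refine ⟨Matrix.of fun x y => if row x = col y then R x y else 0, fun x y h => by simp [h], ?_⟩
  have hRR' : R - (Matrix.of fun x y => if row x = col y then R x y else 0) =
      Matrix.of fun x y => if row x ≠ col y then R x y else 0 := by
    ext x y
    simp only [Matrix.sub_apply, Matrix.of_apply]
    by_cases h : row x = col y <;> simp [h]
  rw [hRR']
  exact rank_offColour_le_exp n row col R t hX

end Summit.PneNP.PneNP.Theorems.CnfIdealGenLengthRankDefectRepresentationsCutLemmaExponential
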